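import Summits.QuantumFields.YangMills.Theorems.UnitScaleTiltProp7SectET3OpsT3
import Summits.QuantumFields.YangMills.Theorems.UnitScaleTiltProp7SectET3OpsCoordPins
import Summits.QuantumFields.YangMills.Theorems.UnitScaleTiltProp7SectET3OpsT3CarrierRows
import HarnessLib

/-!
# Route `UnitScaleTilt` (α), node N06(d = 3), layer 0 ∕ brick L0f — **THE ROWS OF `opsT3` (DEFINER-MEMO's `𝔬_T3`)**: `Identities (opsT3 … i) V` (ALL THIRTEEN FIELDS), the
# letter-symmetry row `hls` and the positivity pin `PosDefEnd ((opsT3 … i).S0 V)` at every index with `1 ≤ i.m` — ✓ `Prop7SectET3OpsCoordPins` (letter-generic κ-fold pins)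
# applied to ✓ `Prop7SectET3OpsT3` (the pins, by `rfl`) with the genuine-currency inputs of ✓ `Prop7SectET3OpsT3CarrierRows` (ym-inputs-p01's letters read back on the route
# carriers); displayed remain ONLY the class `PosOnto` (three slots), the slot facts `hΔ1`∕`hΔs0 hΔsπ hΔs1`, and unitarity of the background for the `(D, Dstar)` member

Cell `ym-inputs` (D-0154 (2); desk INPUT-LIST v8 §4 row p05 «`…SectET3OpsT3Rows` = these applied to the `rfl`s of `def 𝔬_T3`»; p01 GO 2026-08-28T11:12:27Z), seat ym-inputs-p05 g2.
Count-neutral helper (`--supports stmt-QuantumFields-20520 --as helper`); registry untouched; THEOREMS ONLY (0 `def`, 0 `sorry`); NOTHING of [Balaban1985BackgroundPropagators] is asserted.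

WHAT IS PROVED (ns `…Theorems.Prop7SectET3OpsT3Rows`): §1 the weight factor `c₀∕cB` through the composite pins (`rb_eq126`, `rb_c1_inv`, `rb_eq153`, `rb_h124R`); §2 ★★★ `identities_opsT3` — `Identities (opsT3 c₀ cB a Δ0 Δπ Δ1 bI bZ bW i) V` for `1 ≤ i.m` on
the class `PosOnto` of the three slots at `cfgT3 V`, given `hΔ1` (the `Δ₁`-slot kills `D N_S`) and `hΔs1` (it is symmetric) — the 5th conjunct of the analytic row `hmodel` of
✓`normG_row_of_evaluationRowsS`∕`normH₁_row_of_evaluationRowsS` is thereby a THEOREM at the concrete instance, incl. (3.124) (p01's ✓`Eq3124RowsT3` + ✓A); §3 ★★ `letterSymm_opsT3` —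
the row `hls` (`S0`, `Tpi`, `T2` self-transpose from ✓`DeltaEta_isSymmetric`-type slot symmetries; `(D, Dstar)` a transpose pair at unitary-valued `V` from pub-ymgap's
✓`sum_trReForm_cdB`); §4 ★ `posDefEnd_S0_opsT3` — `FormSmall.posS0` from `PosOnto.pos`.
HONEST SCOPE: bookkeeping over landed files; `PosOnto` (Thm 3.11 + `Q` onto, N06) NOT proved; the evaluation rows, the readout row and every analytic size remain; N06(d = 3) NOT
discharged; no summit∕sub-problem claim; rung R3, not Clay.

References: T. Bałaban, CMP **99** (1985) 389–434 [Balaban1985BackgroundPropagators] ((3.120)–(3.130) pp.419–421, (3.124) p.420, (3.147) p.425, (3.153) p.426, Thm 3.11 p.416,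
(3.8) p.392, p.391).
-/

set_option autoImplicit false

noncomputable section

open scoped InnerProductSpace Matrix Matrix.Norms.L2Operator

namespace Summit.QuantumFields.YangMills.Theorems.Prop7SectET3OpsT3Rows

open Literature.MathematicalPhysics.QuantumFieldTheory.Balaban1983to89
open Literature.MathematicalPhysics.QuantumFieldTheory.Balaban1983to89.T3ContinuumYM3Torus
open Literature.MathematicalPhysics.QuantumFieldTheory.Balaban1983to89.B9Thm37Glue (IsTransposePair)
open Literature.MathematicalPhysics.QuantumFieldTheory.Balaban1983to89.B9Thm312Whole (Ops PosDefEnd Identities)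
open B6KLevelCensusIndexV1 (KIdx)
open B6GlobalChartV1 (PV)
open B9GeoNormsKLevelV1 (geo9K)
open B9Eq311L2Pairing (WL2)
open B11Eq103H1Complex (BondL2K)
open B9CoReadingCoords (XBK blkBK coordOpK DcoK DscoK cdBₗ cdsBₗ cdBₗ_apply cdsBₗ_apply)
open B9CoReadingCoordsH (coordOpKH)
open B9CoReadingCoordsTranspose (TrIdx trBasis trBasis_repr_eq_trace trReForm trReForm_apply trReForm_symm isTransposePair_coordOpK_of_adjoint isTransposePair_coordOpK_of_isSymmTr
  sum_trReForm_cdB)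
open B9Thm39ReadingCoords (cR39)
open B9Thm37GlueTorusCov (isTransposePair_smul)
open B7Prop2SpecialUnitary (specialUnitaryUnits_le_unitaryUnits)
open Node00 (FBondY IBondY)
open Node00.OpsYSectDCoords (cR39_trBasis_pos)
open Summit.QuantumFields.YangMills.Theorems.Prop7SectET3Members (hd3)
open Summit.QuantumFields.YangMills.Theorems.Prop7SectET3BgClass (bgT3)
open Summit.QuantumFields.YangMills.Theorems.Prop7SectET3Transport (periodsT3)
open Summit.QuantumFields.YangMills.Theorems.Prop7SectET3HilbertLetters (W₂ toL2 toL2S toL2B DL2 DstarL2)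
open Summit.QuantumFields.YangMills.Theorems.Prop7SectET3GaugeProjector (RS NS)
open Summit.QuantumFields.YangMills.Theorems.Prop7SectET3CurvedPropagators (Qk laplaceA PosOnto GT KinvT HT frakGT HT_eq_comp)
open Summit.QuantumFields.YangMills.Theorems.Prop7SectET3OpsT3HilbertRows (laplaceA_isSymmetric sub_slot_isSymmetric c1_inv_row frakGT_eq h124R_row)
open Summit.QuantumFields.YangMills.Theorems.Prop7SectET3OpsCoordPins (identities_of_coordPins posDefEnd_of_coordPin)
open Summit.QuantumFields.YangMills.Theorems.Prop7SectET3OpsT3ReadingRows (transport_comp_transport transport_id transport_zero transport_sub)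
open Summit.QuantumFields.YangMills.Theorems.Prop7SectET3OpsT3CarrierRows (isSymmTr_readback isAdjTr_one_readback_Qk isAdjTr_readback_DL2 isSymmTr_readback_RS posDefTr_readback_laplaceA
  readback_GT_comp_laplaceA readback_invG readback_invG1 readback_HT_eq_comp readback_frakGT_eq readback_c1_inv readback_h124Q readback_h124R readback_hR)
open Summit.QuantumFields.YangMills.Theorems.Prop7SectET3OpsT3 (nOf nOf_le FT3 cfgT3 ZT3 WT3 opsT3Pins opsT3 opsT3_of_pos)

variable {ℓ : ℕ} {hL : Odd (ℓ + 1) ∧ 1 < ℓ + 1} {b₀ b₁ : ℝ} {c₀ cB a : ℝ} [Fact (0 < c₀)] [Fact (0 < cB)]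
  {Δ0 Δπ Δ1 : ∀ (i : KIdx 2 ℓ hd3 hL b₀ b₁) (hm : 1 ≤ i.m), GaugeField ((FT3 i hm).P i.K) 0 (Matrix.specialUnitaryGroup (Fin 2) ℂ) →
    (BondL2K ℂ 3 (periodsT3 (FT3 i hm) i.K) c₀ W₂ →ₗ[ℂ] BondL2K ℂ 3 (periodsT3 (FT3 i hm) i.K) c₀ W₂)}
  {bI : ∀ i : KIdx 2 ℓ hd3 hL b₀ b₁, FBondY i → IBondY i} {bZ : ∀ i : KIdx 2 ℓ hd3 hL b₀ b₁, PBond (PV 2 ℓ i.m (nOf i) hd3 hL) 0 → IBondY i}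
  {bW : ∀ i : KIdx 2 ℓ hd3 hL b₀ b₁, Site (PV 2 ℓ i.m i.K hd3 hL) 0 → IBondY i}

/-! ## §1 The weight factor `c₀∕cB` through the composite pins (route-carrier level) -/

section Weights

variable {F : T3Family} {n K : ℕ} {h : n ≤ K}
  {Δx : GaugeField (F.P K) 0 (Matrix.specialUnitaryGroup (Fin 2) ℂ) → (BondL2K ℂ 3 (periodsT3 F K) c₀ W₂ →ₗ[ℂ] BondL2K ℂ 3 (periodsT3 F K) c₀ W₂)}

/-- `eq126`∕`eq129` shape with the weight factors on `Q_k†` and `(QGQ*)⁻¹` (they cancel): `toL2⁻¹ H toL2B = (toL2⁻¹ G toL2) ∘ ((c₀∕cB)•toL2⁻¹ Q† toL2B) ∘ ((cB∕c₀)•toL2B⁻¹ C toL2B)` ON THE CLASS.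
[cite: Balaban1985BackgroundPropagators, (3.126) p.420, (3.129) p.421] -/
theorem rb_eq126 {U₀ : GaugeField (F.P K) 0 (Matrix.specialUnitaryGroup (Fin 2) ℂ)} (hp : PosOnto F n K h c₀ cB a Δx U₀) (hw' : (((cB / c₀ : ℝ) : ℂ)) * (((c₀ / cB : ℝ) : ℂ)) = 1) :
    (toL2 F K c₀).symm.toLinearMap ∘ₗ HT F n K h c₀ cB a Δx U₀ ∘ₗ (toL2B F n cB).toLinearMap =
      ((toL2 F K c₀).symm.toLinearMap ∘ₗ GT F n K h c₀ cB a Δx U₀ ∘ₗ (toL2 F K c₀).toLinearMap) ∘ₗ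
        ((((c₀ / cB : ℝ) : ℂ)) • ((toL2 F K c₀).symm.toLinearMap ∘ₗ LinearMap.adjoint (Qk F n K h c₀ cB U₀) ∘ₗ (toL2B F n cB).toLinearMap)) ∘ₗ
          ((((cB / c₀ : ℝ) : ℂ)) • ((toL2B F n cB).symm.toLinearMap ∘ₗ KinvT F n K h c₀ cB a Δx U₀ ∘ₗ (toL2B F n cB).toLinearMap)) := by
  simp only [LinearMap.comp_smul, LinearMap.smul_comp, smul_smul, hw', one_smul]
  rw [transport_comp_transport, transport_comp_transport, ← HT_eq_comp hp]

/-- `c1_inv` shape with the weight factors (they cancel) ON THE CLASS. [cite: Balaban1985BackgroundPropagators, (3.126) p.420] -/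
theorem rb_c1_inv {U₀ : GaugeField (F.P K) 0 (Matrix.specialUnitaryGroup (Fin 2) ℂ)} (hp : PosOnto F n K h c₀ cB a Δx U₀) (hw' : (((cB / c₀ : ℝ) : ℂ)) * (((c₀ / cB : ℝ) : ℂ)) = 1) :
    ((toL2B F n cB).symm.toLinearMap ∘ₗ Qk F n K h c₀ cB U₀ ∘ₗ (toL2 F K c₀).toLinearMap) ∘ₗ
        ((toL2 F K c₀).symm.toLinearMap ∘ₗ GT F n K h c₀ cB a Δx U₀ ∘ₗ (toL2 F K c₀).toLinearMap) ∘ₗ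
          ((((c₀ / cB : ℝ) : ℂ)) • ((toL2 F K c₀).symm.toLinearMap ∘ₗ LinearMap.adjoint (Qk F n K h c₀ cB U₀) ∘ₗ (toL2B F n cB).toLinearMap)) ∘ₗ
            ((((cB / c₀ : ℝ) : ℂ)) • ((toL2B F n cB).symm.toLinearMap ∘ₗ KinvT F n K h c₀ cB a Δx U₀ ∘ₗ (toL2B F n cB).toLinearMap)) = LinearMap.id := by
  simp only [LinearMap.comp_smul, LinearMap.smul_comp, smul_smul, hw', one_smul]
  rw [transport_comp_transport, transport_comp_transport, transport_comp_transport, c1_inv_row hp, transport_id]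

/-- `eq153` shape with the weight factors (they cancel), hypothesis-free. [cite: Balaban1985BackgroundPropagators, (3.153) p.426] -/
theorem rb_eq153 (U₀ : GaugeField (F.P K) 0 (Matrix.specialUnitaryGroup (Fin 2) ℂ)) (hw' : (((cB / c₀ : ℝ) : ℂ)) * (((c₀ / cB : ℝ) : ℂ)) = 1) :
    (toL2 F K c₀).symm.toLinearMap ∘ₗ frakGT F n K h c₀ cB a Δx U₀ ∘ₗ (toL2 F K c₀).toLinearMap =
      ((toL2 F K c₀).symm.toLinearMap ∘ₗ GT F n K h c₀ cB a Δx U₀ ∘ₗ (toL2 F K c₀).toLinearMap) ∘ₗ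
        (LinearMap.id -
          ((((c₀ / cB : ℝ) : ℂ)) • ((toL2 F K c₀).symm.toLinearMap ∘ₗ LinearMap.adjoint (Qk F n K h c₀ cB U₀) ∘ₗ (toL2B F n cB).toLinearMap)) ∘ₗ
            ((((cB / c₀ : ℝ) : ℂ)) • ((toL2B F n cB).symm.toLinearMap ∘ₗ KinvT F n K h c₀ cB a Δx U₀ ∘ₗ (toL2B F n cB).toLinearMap)) ∘ₗ
              ((toL2B F n cB).symm.toLinearMap ∘ₗ Qk F n K h c₀ cB U₀ ∘ₗ (toL2 F K c₀).toLinearMap) ∘ₗ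
                ((toL2 F K c₀).symm.toLinearMap ∘ₗ GT F n K h c₀ cB a Δx U₀ ∘ₗ (toL2 F K c₀).toLinearMap) -
          ((toL2 F K c₀).symm.toLinearMap ∘ₗ DL2 F n K c₀ U₀ ∘ₗ (toL2S F K c₀).toLinearMap) ∘ₗ
            ((toL2S F K c₀).symm.toLinearMap ∘ₗ RS F n K h c₀ cB U₀ ∘ₗ (toL2S F K c₀).toLinearMap) ∘ₗ
              ((toL2S F K c₀).symm.toLinearMap ∘ₗ DstarL2 F n K c₀ U₀ ∘ₗ (toL2 F K c₀).toLinearMap) ∘ₗ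
                ((toL2 F K c₀).symm.toLinearMap ∘ₗ GT F n K h c₀ cB a Δx U₀ ∘ₗ (toL2 F K c₀).toLinearMap)) := by
  simp only [LinearMap.comp_smul, LinearMap.smul_comp, smul_smul, hw', one_smul]
  rw [transport_comp_transport, transport_comp_transport, transport_comp_transport, transport_comp_transport, transport_comp_transport, transport_comp_transport,
    ← transport_id (toL2 F K c₀), ← transport_sub, ← transport_sub, transport_comp_transport, ← frakGT_eq]

/-- `h124R` shape with the weight factor on `Q_k†` ON THE CLASS. [cite: Balaban1985BackgroundPropagators, (3.124) p.420] -/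
theorem rb_h124R {U₀ : GaugeField (F.P K) 0 (Matrix.specialUnitaryGroup (Fin 2) ℂ)} (hp : PosOnto F n K h c₀ cB a Δx U₀) (hΔs : (Δx U₀).IsSymmetric)
    (hΔ : ∀ l ∈ NS F n K h c₀ cB U₀, Δx U₀ (DL2 F n K c₀ U₀ l) = 0) :
    ((toL2S F K c₀).symm.toLinearMap ∘ₗ RS F n K h c₀ cB U₀ ∘ₗ (toL2S F K c₀).toLinearMap) ∘ₗ
        ((toL2S F K c₀).symm.toLinearMap ∘ₗ DstarL2 F n K c₀ U₀ ∘ₗ (toL2 F K c₀).toLinearMap) ∘ₗ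
          ((toL2 F K c₀).symm.toLinearMap ∘ₗ GT F n K h c₀ cB a Δx U₀ ∘ₗ (toL2 F K c₀).toLinearMap) ∘ₗ
            ((((c₀ / cB : ℝ) : ℂ)) • ((toL2 F K c₀).symm.toLinearMap ∘ₗ LinearMap.adjoint (Qk F n K h c₀ cB U₀) ∘ₗ (toL2B F n cB).toLinearMap)) = 0 := by
  simp only [LinearMap.comp_smul]
  rw [transport_comp_transport, transport_comp_transport, transport_comp_transport, h124R_row hp hΔs hΔ, transport_zero, smul_zero]

end Weights

/-! ## §2 `Identities (opsT3 … i) V` -/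

set_option maxRecDepth 8192 in
/-- ★★★ **`Identities (opsT3 … i) V` ON THE CLASS, AT EVERY INDEX WITH `1 ≤ i.m`** — all thirteen fields of Track A's schema for the concrete T³ letter record: ✓`identities_of_coordPins`
at the pins of ✓`opsT3Pins` (by `rfl`) with the operator identities ∕ adjointness of ✓`Prop7SectET3OpsT3CarrierRows` (p01's letters read back; ✓A's (3.124) triple inside).
Displayed: `PosOnto` of the three slots at `cfgT3 V` (Thm 3.11 + `Q` onto), `hΔ1`, `hΔs1`. [cite: Balaban1985BackgroundPropagators, (3.120)–(3.130) pp.419–421, (3.124) p.420, (3.147) p.425, (3.152)–(3.153) p.426, p.391] -/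
theorem identities_opsT3 {i : KIdx 2 ℓ hd3 hL b₀ b₁} (hm : 1 ≤ i.m) {V : (bgT3 i).Cfg}
    (hp0 : PosOnto (FT3 i hm) (nOf i) i.K (nOf_le i) c₀ cB a (Δ0 i hm) (cfgT3 V)) (hpπ : PosOnto (FT3 i hm) (nOf i) i.K (nOf_le i) c₀ cB a (Δπ i hm) (cfgT3 V))
    (hp1 : PosOnto (FT3 i hm) (nOf i) i.K (nOf_le i) c₀ cB a (Δ1 i hm) (cfgT3 V))
    (hΔ1 : ∀ l ∈ NS (FT3 i hm) (nOf i) i.K (nOf_le i) c₀ cB (cfgT3 V), Δ1 i hm (cfgT3 V) (DL2 (FT3 i hm) (nOf i) i.K c₀ (cfgT3 V) l) = 0)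
    (hΔs1 : (Δ1 i hm (cfgT3 V)).IsSymmetric) :
    Identities (opsT3 c₀ cB a Δ0 Δπ Δ1 bI bZ bW i) V := by
  rw [opsT3_of_pos hm]
  have hc : cR39 (trBasis 2) ≠ 0 := (cR39_trBasis_pos (by norm_num)).ne'
  have hc₀ : c₀ ≠ 0 := (Fact.out : 0 < c₀).ne'
  have hcB : cB ≠ 0 := (Fact.out : 0 < cB).ne'
  have hw2 : (((cB / c₀ : ℝ) : ℂ)) * (((c₀ / cB : ℝ) : ℂ)) = 1 := by
    rw [← Complex.ofReal_mul, div_mul_div_comm, mul_comm cB c₀, div_self (mul_ne_zero hc₀ hcB), Complex.ofReal_one]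
  refine identities_of_coordPins (trBasis 2) (trBasis_repr_eq_trace 2) _ V hc _ _ _ _ _ _ _ _ _ _ _ _ _ _ _ _
    rfl rfl rfl rfl rfl rfl rfl rfl rfl rfl rfl rfl rfl rfl rfl rfl
    (readback_GT_comp_laplaceA hp0) (readback_invG hpπ) (readback_invG1 hp1) ?_ ?_ ?_ ?_ (readback_h124Q hp1 hΔ1) ?_ (readback_hR hp1 hΔ1)
    (isAdjTr_one_readback_Qk (F := FT3 i hm) (n := nOf i) (K := i.K) (h := nOf_le i) (c₀ := c₀) (cB := cB) (cfgT3 V))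
    (isAdjTr_readback_DL2 (F := FT3 i hm) (n := nOf i) (K := i.K) (c₀ := c₀) (cfgT3 V)) (isSymmTr_readback_RS (F := FT3 i hm) (n := nOf i) (K := i.K) (h := nOf_le i) (c₀ := c₀) (cB := cB) (cfgT3 V))
  · exact rb_eq126 hpπ hw2
  · exact rb_eq126 hp1 hw2
  · exact rb_eq153 (F := FT3 i hm) (n := nOf i) (K := i.K) (h := nOf_le i) (a := a) (Δx := Δ1 i hm) (cfgT3 V) hw2
  · exact rb_c1_inv hp1 hw2
  · exact rb_h124R hp1 hΔs1 hΔ1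

/-! ## §3 The letter-symmetry row `hls` -/

/-- def-Y's covariant differences `(∇_U, ∇*_U)` on the κ-fold carrier are a transpose pair at a unitary-valued background (pub-ymgap's ✓`sum_trReForm_cdB` through
✓`isTransposePair_coordOpK_of_adjoint`). [cite: Balaban1985BackgroundPropagators, (3.8) p.392] -/
theorem isTransposePair_DcoK_DscoK (i : KIdx 2 ℓ hd3 hL b₀ b₁) (V : (bgT3 i).Cfg)
    (hU : ∀ μ x, ((V μ x : (Matrix (Fin 2) (Fin 2) ℂ)ˣ) : Matrix (Fin 2) (Fin 2) ℂ) ∈ unitary (Matrix (Fin 2) (Fin 2) ℂ)) :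
    IsTransposePair (DcoK i (trBasis 2) (bgT3 i) (fun V => V) V) (DscoK i (trBasis 2) (bgT3 i) (fun V => V) V) := by
  unfold DcoK DscoK
  refine isTransposePair_coordOpK_of_adjoint (trBasis 2) trReForm trReForm_symm (fun v c => by rw [trBasis_repr_eq_trace, trReForm_apply]) _ _ fun ν Φ Ψ => ?_
  simp only [cdBₗ_apply, cdsBₗ_apply]
  exact sum_trReForm_cdB i V hU ν Φ Ψ

/-- ★★ **THE LETTER-SYMMETRY ROW `hls` FOR `opsT3`** at an index with `1 ≤ i.m` and a unitary-valued background: `S0`, `Tpi`, `T2` self-transpose (slots symmetric — p01's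
✓`DeltaEta_isSymmetric`∕`DeltaPiSlot_isSymmetric`∕`DeltaOne_isSymmetric`), `(D, Dstar)` a transpose pair. [cite: Balaban1985BackgroundPropagators, p.391, (3.8) p.392, (3.26) p.395, (3.120) p.419, (3.134) p.422] -/
theorem letterSymm_opsT3 {i : KIdx 2 ℓ hd3 hL b₀ b₁} (hm : 1 ≤ i.m) {V : (bgT3 i).Cfg}
    (hU : ∀ μ x, ((V μ x : (Matrix (Fin 2) (Fin 2) ℂ)ˣ) : Matrix (Fin 2) (Fin 2) ℂ) ∈ unitary (Matrix (Fin 2) (Fin 2) ℂ))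
    (hΔs0 : (Δ0 i hm (cfgT3 V)).IsSymmetric) (hΔsπ : (Δπ i hm (cfgT3 V)).IsSymmetric) (hΔs1 : (Δ1 i hm (cfgT3 V)).IsSymmetric) :
    IsTransposePair ((opsT3 c₀ cB a Δ0 Δπ Δ1 bI bZ bW i).S0 V) ((opsT3 c₀ cB a Δ0 Δπ Δ1 bI bZ bW i).S0 V) ∧
      IsTransposePair ((opsT3 c₀ cB a Δ0 Δπ Δ1 bI bZ bW i).Tpi V) ((opsT3 c₀ cB a Δ0 Δπ Δ1 bI bZ bW i).Tpi V) ∧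
        IsTransposePair ((opsT3 c₀ cB a Δ0 Δπ Δ1 bI bZ bW i).T2 V) ((opsT3 c₀ cB a Δ0 Δπ Δ1 bI bZ bW i).T2 V) ∧
          IsTransposePair ((opsT3 c₀ cB a Δ0 Δπ Δ1 bI bZ bW i).D V) ((opsT3 c₀ cB a Δ0 Δπ Δ1 bI bZ bW i).Dstar V) := by
  rw [opsT3_of_pos hm]
  exact ⟨isTransposePair_smul (isTransposePair_coordOpK_of_isSymmTr (trBasis 2) (trBasis_repr_eq_trace 2) _ (isSymmTr_readback (laplaceA_isSymmetric hΔs0))) _,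
    isTransposePair_smul (isTransposePair_coordOpK_of_isSymmTr (trBasis 2) (trBasis_repr_eq_trace 2) _ (isSymmTr_readback (sub_slot_isSymmetric hΔs0 hΔsπ))) _,
    isTransposePair_smul (isTransposePair_coordOpK_of_isSymmTr (trBasis 2) (trBasis_repr_eq_trace 2) _ (isSymmTr_readback (sub_slot_isSymmetric hΔsπ hΔs1))) _,
    isTransposePair_DcoK_DscoK i V hU⟩

/-! ## §4 The positivity pin `FormSmall.posS0` -/

/-- ★ **`PosDefEnd ((opsT3 … i).S0 V)` ON THE CLASS OF THE `Δ`-SLOT** (`FormSmall.posS0`, Theorem 3.11's meaning) — from `PosOnto.pos` through ✓`posDefTr_readback_laplaceA` and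
✓`posDefEnd_of_coordPin`. [cite: Balaban1985BackgroundPropagators, Thm 3.11 p.416] -/
theorem posDefEnd_S0_opsT3 {i : KIdx 2 ℓ hd3 hL b₀ b₁} (hm : 1 ≤ i.m) {V : (bgT3 i).Cfg} (hp0 : PosOnto (FT3 i hm) (nOf i) i.K (nOf_le i) c₀ cB a (Δ0 i hm) (cfgT3 V)) :
    PosDefEnd ((opsT3 c₀ cB a Δ0 Δπ Δ1 bI bZ bW i).S0 V) := by
  rw [opsT3_of_pos hm]
  exact posDefEnd_of_coordPin (trBasis 2) (trBasis_repr_eq_trace 2) (cR39_trBasis_pos (by norm_num)) _ (posDefTr_readback_laplaceA hp0)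

end Summit.QuantumFields.YangMills.Theorems.Prop7SectET3OpsT3Rows

end
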